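import Summits.Schanuel.Schanuel.Theorems.DiophantineDichotomyApproximationPropertyCurveHilbertLB
import Summits.Schanuel.Schanuel.Theorems.DiophantineDichotomyApproximationPropertyCycleAPIAt3GlueLemmas
import HarnessLib

/-!
# Enveloped deficient orbits are long relative to their satellite (crux `ApproximationProperty`, stmt-Schanuel-6117)

Crux `stmt-Schanuel-6117` (`Summit.Schanuel.Schanuel.Theses.DiophantineDichotomy.ApproximationProperty`),
route `DiophantineDichotomy`, line `orbit-interpolation-determinant`, lead c8
(`prover-line-stmt-Schanuel-6117-c8-0`), skeleton v21 (`Cruxes/ApproximationProperty/Lines/orbit_interpolation_determinant.lean`),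
memo `Cruxes/ApproximationProperty/KERNEL-c8.md` §2 (E1). Registered sub-goal `farDef_orbit_length`
(`--supports stmt-Schanuel-6117`).

A ready-made consequence of the two hypotheses that skeleton v21 adds to the open far-satellite stub
`pointDatum_of_farSatellite3_def`: if the satellite `𝔮'` (a prime of `dim ℚ[x̲]/𝔮' = 2` through the c.i. curve
`(Q, P)`, `𝔮' ≤ 𝔭`) ENVELOPS the orbit `𝔭` at level `ν` (`ℚ[x̲]_ν ∩ 𝔭 ⊆ 𝔮'`) and the orbit is DEFICIENT there
(`K₀ · dim ℚ[x̲]_ν < deg 𝔭 + K₀ · dim(ℚ[x̲]_ν ∩ 𝔭)`), then the orbit is LONG relative to the satellite: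
`K₀ · (ν − a − b) · deg 𝔮' < deg 𝔭`. Proof: by the envelope `ℚ[x̲]_ν ∩ 𝔭 = ℚ[x̲]_ν ∩ 𝔮'`, and the landed lower
bound for the Hilbert function of a curve through `(Q, P)` (`curveHilbert_lowerBound`:
`(ν − a − b) deg 𝔮' + dim(𝔮' ∩ ℚ[x̲]_ν) ≤ dim ℚ[x̲]_ν`) turns deficiency into length.

Sources: NesterenkoPhilippon2001 (LNM 1752) Ch. 3 §4 (degree / Hilbert function of unmixed ideals); the line's
memos KERNEL-c6.md (R1, R3), KERNEL-c8.md (§2).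
-/

noncomputable section

-- `Summit.Schanuel.Schanuel.…` is the mandated summit/sub-problem namespace (single-conjunct summit), hence:
set_option linter.dupNamespace false

attribute [local instance] MvPolynomial.gradedAlgebra

namespace Summit.Schanuel.Schanuel.Cruxes.ApproximationProperty.OrbitInterpolationDeterminant

open Literature.NumberTheory.Transcendental.Nesterenko MvPolynomial
open scoped BigOperators

namespace FarDefLength

/-- Under the envelope `ℚ[x̲]_ν ∩ 𝔭 ⊆ 𝔮'` with `𝔮' ≤ 𝔭`, the orbit and the satellite have the same forms of
degree `ν`: `ℚ[x̲]_ν ∩ 𝔭 = ℚ[x̲]_ν ∩ 𝔮'`. [folklore] -/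
theorem inf_eq_of_envelope {𝔭 𝔮' : Ideal (Rx 3)} {ν : ℕ} (hle : 𝔮' ≤ 𝔭)
    (henv : homogeneousSubmodule (Fin (3 + 1)) ℚ ν ⊓ 𝔭.restrictScalars ℚ ≤ 𝔮'.restrictScalars ℚ) :
    homogeneousSubmodule (Fin (3 + 1)) ℚ ν ⊓ 𝔭.restrictScalars ℚ =
      homogeneousSubmodule (Fin (3 + 1)) ℚ ν ⊓ 𝔮'.restrictScalars ℚ := by
  refine le_antisymm (le_inf inf_le_left henv) (inf_le_inf_left _ ?_)
  intro x hx
  exact hle hx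

end FarDefLength

/-- **Registered sub-goal `farDef_orbit_length`** (KERNEL-c8.md §2 (E1), made formal): for the c.i. curve
`(Q, P)` of `ℚ[x₀, …, x₃]` (`(Q)` prime of degree `a ≥ 1`, `P ∉ (Q)` of degree `b ≥ 1`), a satellite `𝔮'`
(prime, homogeneous, unmixed of rank `2`, containing `Q` and `P`) below the orbit `𝔭` (`𝔮' ≤ 𝔭`), a level
`ν ≥ a + b` at which `𝔮'` ENVELOPS `𝔭` (`ℚ[x̲]_ν ∩ 𝔭 ⊆ 𝔮'`) and at which `𝔭` is `K₀`-DEFICIENT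
(`K₀·dim ℚ[x̲]_ν < deg 𝔭 + K₀·dim(ℚ[x̲]_ν ∩ 𝔭)`): the orbit is long, `K₀ (ν − a − b) deg 𝔮' < deg 𝔭`.
[cite: NesterenkoPhilippon2001, Ch. 3 Prop. 4.7, 4.11 (Hilbert function of a curve section)] -/
theorem farDef_orbit_length : ∀ (Q P : Rx 3) (a b : ℕ), Q ≠ 0 → Q.IsHomogeneous a → P.IsHomogeneous b →
    1 ≤ a → 1 ≤ b → (Ideal.span {Q}).IsPrime → P ∉ Ideal.span {Q} →
    ∀ (𝔭 𝔮' : Ideal (Rx 3)) (ν K₀ : ℕ), 𝔮'.IsPrime →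
    𝔮'.IsHomogeneous (homogeneousSubmodule (Fin (3 + 1)) ℚ) → IsUnmixedOfRank 𝔮' 2 → Q ∈ 𝔮' → P ∈ 𝔮' →
    𝔮' ≤ 𝔭 → a + b ≤ ν →
    homogeneousSubmodule (Fin (3 + 1)) ℚ ν ⊓ 𝔭.restrictScalars ℚ ≤ 𝔮'.restrictScalars ℚ →
    K₀ * Module.finrank ℚ ↥(homogeneousSubmodule (Fin (3 + 1)) ℚ ν) <
      ideg 𝔭 1 + K₀ * Module.finrank ℚ ↥(homogeneousSubmodule (Fin (3 + 1)) ℚ ν ⊓ 𝔭.restrictScalars ℚ) →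
    K₀ * ((ν - a - b) * ideg 𝔮' 2) < ideg 𝔭 1 := by
  intro Q P a b hQ0 hQ hP ha hb hprime hPQ 𝔭 𝔮' ν K₀ h𝔮'p h𝔮'h h𝔮'u hQ𝔮' hP𝔮' hle hν henv hdef
  have hdim : ringKrullDim (Rx 3 ⧸ 𝔮') = (2 : ℕ) := SatelliteRestartGlue.rank_eq_two h𝔮'p h𝔮'u
  have hH := curveHilbert_lowerBound Q P a b hQ0 hQ hP ha hb hprime hPQ 𝔮' h𝔮'p h𝔮'h hQ𝔮' hP𝔮' hdim ν hν
  -- `idealDegree 𝔮' ν = ℚ[x]_ν ∩ 𝔮' = ℚ[x]_ν ∩ 𝔭`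
  have hideg : Literature.RingTheory.MvPolynomial.idealDegree 𝔮' ν =
      homogeneousSubmodule (Fin (3 + 1)) ℚ ν ⊓ 𝔭.restrictScalars ℚ := by
    rw [FarDefLength.inf_eq_of_envelope hle henv, Literature.RingTheory.MvPolynomial.idealDegree, inf_comm]
  rw [hideg] at hH
  -- bookkeeping in `ℕ`
  set D := ideg 𝔭 1
  set e := ideg 𝔮' 2
  set F := Module.finrank ℚ ↥(homogeneousSubmodule (Fin (3 + 1)) ℚ ν)
  set G := Module.finrank ℚ ↥(homogeneousSubmodule (Fin (3 + 1)) ℚ ν ⊓ 𝔭.restrictScalars ℚ)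
  have h1 : K₀ * ((ν - a - b) * e) + K₀ * G ≤ K₀ * F := by
    rw [← Nat.mul_add]; exact Nat.mul_le_mul_left K₀ hH
  omega

end Summit.Schanuel.Schanuel.Cruxes.ApproximationProperty.OrbitInterpolationDeterminant

end
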